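import Summits.MatrixMultiplication.MatrixMultiplication.Theorems.ObstructionDescentInvariantTower

set_option linter.dupNamespace false

/-!
# Passing levels are the levels of the secant variety of the corner format (decomp-mm · lens 3 · gen 11, hand theorem H9 made kernel)

Route `route-MatrixMultiplication-ObstructionDescent`, support for the aside `InvariantSaturation` (item
`stmt-MatrixMultiplication-32282`); continues `ObstructionDescentInvariantTower` (levels `passLevels` / `pointLevels` / `emptyLevels`,
the corner projection `lastProj`).

A weight vector of a RIGHT-aligned rectangular type `rectType m N k` does not see the first `m − N` coordinates: the block scalar
`D_ε = diag(ε,…,ε,1,…,1)` acts on it through the trivial character, so `ε ↦ f(D_ε³·t)` is a constant polynomial and its value at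
`ε = 0` — the evaluation at the CORNER PROJECTION `P³·t`, `P = lastProj m N` — equals `f(t)` (`evalT_lastProj_of_mem_hwvSpace`).
Consequently (**H9**, `mem_passLevels_iff_corner`) a level passes iff it has a weight vector non-zero at some corner point
`[PA|PB|PC]` — a sum of `m` triads supported in the last-`N` cube, i.e. a tensor of rank `≤ m` of the corner format `N³`:
**`passLevels m N` = the levels whose weight vectors (equivalently, by inheritance, the `SL_N³`-invariants of degree `kN`) do not
all vanish on the secant variety `σ_m(ℂ^N ⊗ ℂ^N ⊗ ℂ^N)`**, and `InvariantSaturation` is a statement about secant varieties of the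
FIXED format `n² × n² × n²` with `m` entering only as the secant order (`invariantSaturation_iff_corner`).  The witness principle of
`ObstructionDescentWitnessPoints` is the direction `⇐`.  Inheritance: Landsberg, *Geometry and Complexity Theory* §8.3.3.
All statements over landed definitions; no proposition is defined; no `sorry`; standard axioms.
[cite: BurgisserIkenmeyer2017, §5 (5.2), Thm 5.3; BurgisserIkenmeyer2011, §2 (2.2), Lemma 3.2; LandsbergGCT2017, §8.3.3]
-/

noncomputable section

open scoped BigOperators
open Finset

namespace Summit.MatrixMultiplication.MatrixMultiplication.Theorems.ObstructionCalculus

/-! ### H9 · The secant characterisation of passing levels (the converse of the witness principle)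

A weight vector of a RIGHT-aligned rectangular type does not see the first `m − N` coordinates: acting by the block scalar
`D_ε = diag(ε,…,ε,1,…,1)` multiplies its value by the character `1`, and the polynomial `ε ↦ f(D_ε³·t)` is then constant, so its
value at `ε = 0` — the evaluation at the CORNER PROJECTION `P³·t`, `P = lastProj m N` — equals `f(t)`.  Consequently a level passes
iff it has a weight vector non-zero at some corner point `[PA|PB|PC]` — a sum of `m` triads supported in the last-`N` cube, i.e. a
tensor of rank `≤ m` of the corner format `N³`: **`passLevels m N` = the levels whose invariants do not vanish identically on the
`m`-th secant variety `σ_m(ℂ^N ⊗ ℂ^N ⊗ ℂ^N)`** (`mem_passLevels_iff_corner`).  The invariant tower is therefore a statement about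
secant varieties of the FIXED format `n² × n² × n²`, with `m` entering only as the secant order (`invariantSaturation_iff_corner`). -/

section SecantCharacterisation

open Literature.Computability.AlgebraicComplexity (actTensor unitTensor)

variable {m : ℕ}

/-- The number of slot indices of `p` OUTSIDE the last-`N` block. [bookkeeping] -/
def lowCount (N : ℕ) (p : Idx m) : ℕ :=
  (if m ≤ (p.1 : ℕ) + N then 0 else 1) + ((if m ≤ (p.2.1 : ℕ) + N then 0 else 1) +
    (if m ≤ (p.2.2 : ℕ) + N then 0 else 1))

variable (m) in
/-- The block scalar `(ε,…,ε,1,…,1)`: `ε` on the first `m − N` coordinates, `1` on the last `N`. [bookkeeping] -/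
def blockScalar (N : ℕ) (ε : ℂ) : Fin m → ℂ := fun i => if m ≤ (i : ℕ) + N then 1 else ε

/-- At `ε = 0` the block scalar matrix is the corner projection `lastProj`. [bookkeeping] -/
theorem diagonal_blockScalar_zero (N : ℕ) : Matrix.diagonal (blockScalar m N 0) = lastProj m N := rfl

/-- A right-aligned rectangular character is trivial on the block scalars. [bookkeeping] -/
theorem weightChar_rectType_blockScalar (N k : ℕ) (s : Fin 3) (ε : ℂ) :
    weightChar (rectType m N k s) (Matrix.diagonal (blockScalar m N ε)) = 1 := by
  rw [weightChar_diagonal]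
  refine Finset.prod_eq_one fun i _ => ?_
  unfold rectType blockScalar
  split_ifs <;> simp

/-- The block scalars act on an entry by `ε^{lowCount}`. [bookkeeping] -/
theorem actTensor_blockScalar (N : ℕ) (ε : ℂ) (t : Tensor ℂ m) (a b c : Fin m) :
    actTensor (Matrix.diagonal (blockScalar m N ε)) (Matrix.diagonal (blockScalar m N ε))
      (Matrix.diagonal (blockScalar m N ε)) t a b c = ε ^ lowCount N (a, b, c) * t a b c := by
  rw [actTensor_diagonal]
  simp only [blockScalar, lowCount]
  split_ifs <;> ring

/-- The one-variable polynomial `ε ↦ f(D_ε³·t)`. [bookkeeping] -/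
def blockPoly (N : ℕ) (t : Tensor ℂ m) (f : MvPolynomial (Idx m) ℂ) : Polynomial ℂ :=
  MvPolynomial.aeval (fun p : Idx m => Polynomial.C (t p.1 p.2.1 p.2.2) * Polynomial.X ^ lowCount N p) f

/-- `blockPoly` evaluates to `f(D_ε³·t)`. [bookkeeping] -/
theorem eval_blockPoly (N : ℕ) (t : Tensor ℂ m) (f : MvPolynomial (Idx m) ℂ) (ε : ℂ) :
    (blockPoly N t f).eval ε = evalT (actTensor (Matrix.diagonal (blockScalar m N ε))
      (Matrix.diagonal (blockScalar m N ε)) (Matrix.diagonal (blockScalar m N ε)) t) f := by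
  have h1 : (blockPoly N t f).eval ε = (Polynomial.aeval ε) (blockPoly N t f) := by
    rw [Polynomial.coe_aeval_eq_eval]
  rw [h1, blockPoly, ← AlgHom.comp_apply, MvPolynomial.comp_aeval]
  unfold evalT
  have hfun : (fun p : Idx m => (Polynomial.aeval ε) (Polynomial.C (t p.1 p.2.1 p.2.2) * Polynomial.X ^ lowCount N p)) =
      fun p : Idx m => actTensor (Matrix.diagonal (blockScalar m N ε)) (Matrix.diagonal (blockScalar m N ε))
        (Matrix.diagonal (blockScalar m N ε)) t p.1 p.2.1 p.2.2 := by
    funext p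
    rw [actTensor_blockScalar, Polynomial.coe_aeval_eq_eval, Polynomial.eval_mul, Polynomial.eval_C, Polynomial.eval_pow,
      Polynomial.eval_X, mul_comm]
  rw [hfun]

/-- **Block-scalar invariance.**  A weight vector of right-aligned rectangular type is invariant under `D_ε³`, `ε ≠ 0`. [this node] -/
theorem evalT_blockScalar_of_mem_hwvSpace {N k : ℕ} {f : MvPolynomial (Idx m) ℂ}
    (hf : f ∈ hwvSpace (rectType m N k) (k * N)) {ε : ℂ} (hε : ε ≠ 0) (t : Tensor ℂ m) :
    evalT (actTensor (Matrix.diagonal (blockScalar m N ε)) (Matrix.diagonal (blockScalar m N ε))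
      (Matrix.diagonal (blockScalar m N ε)) t) f = evalT t f := by
  have hD : Matrix.diagonal (blockScalar m N ε) ∈ borel m :=
    diagonal_mem_borel fun i => by
      unfold blockScalar
      split_ifs
      · exact one_ne_zero
      · exact hε
  rw [hf.2 _ _ _ hD hD hD t, weightChar_rectType_blockScalar, weightChar_rectType_blockScalar,
    weightChar_rectType_blockScalar]
  ring

/-- **Corner projection.**  A weight vector of right-aligned rectangular type takes the same value at `t` and at its corner
projection `P³·t` (polynomial identity in `ε`, evaluated at `ε = 0`). [this node] -/
theorem evalT_lastProj_of_mem_hwvSpace {N k : ℕ} {f : MvPolynomial (Idx m) ℂ}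
    (hf : f ∈ hwvSpace (rectType m N k) (k * N)) (t : Tensor ℂ m) :
    evalT (actTensor (lastProj m N) (lastProj m N) (lastProj m N) t) f = evalT t f := by
  have hroots : ∀ ε : ℂ, ε ≠ 0 → (blockPoly N t f - Polynomial.C (evalT t f)).IsRoot ε := by
    intro ε hε
    rw [Polynomial.IsRoot, Polynomial.eval_sub, Polynomial.eval_C, eval_blockPoly,
      evalT_blockScalar_of_mem_hwvSpace hf hε, sub_self]
  have hzero : blockPoly N t f - Polynomial.C (evalT t f) = 0 := by
    apply Polynomial.eq_zero_of_infinite_isRoot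
    exact Set.Infinite.mono (fun ε (hε : ε ∈ ({0} : Set ℂ)ᶜ) => hroots ε (by simpa using hε))
      (Set.finite_singleton 0).infinite_compl
  have h0 := congrArg (Polynomial.eval 0) hzero
  rw [Polynomial.eval_sub, Polynomial.eval_C, Polynomial.eval_zero, sub_eq_zero, eval_blockPoly,
    diagonal_blockScalar_zero] at h0
  exact h0

/-- **H9 · secant characterisation of passing levels.**  A level passes iff it has a weight vector NON-ZERO AT A CORNER POINT
`[PA|PB|PC]` (`P = lastProj m N`) — a tensor of rank `≤ m` supported in the last-`N` cube, i.e. a point of `σ_m` of the corner format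
`N³`; the witness principle is the direction `⇐`. [this node] -/
theorem mem_passLevels_iff_corner {N k : ℕ} : k ∈ passLevels m N ↔
    ∃ A B C : Matrix (Fin m) (Fin m) ℂ,
      k ∈ pointLevels N (fromCols (lastProj m N * A) (lastProj m N * B) (lastProj m N * C)) := by
  constructor
  · intro hk
    obtain ⟨f, hfW, hfOV⟩ := SetLike.not_le_iff_exists.1 hk
    simp only [mem_orbitVanishing, not_forall] at hfOV
    obtain ⟨A, B, C, _, _, _, hne⟩ := hfOV
    refine ⟨A, B, C, f, hfW, ?_⟩
    rw [← actTensor_fromCols, evalT_lastProj_of_mem_hwvSpace hfW, ← actTensor_unitTensor]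
    exact hne
  · rintro ⟨A, B, C, f, hfW, hne⟩ hle
    apply hne
    rw [← actTensor_fromCols, evalT_lastProj_of_mem_hwvSpace hfW]
    exact evalT_fromCols_eq_zero_of_mem_orbitVanishing (hle hfW) A B C

end SecantCharacterisation

end Summit.MatrixMultiplication.MatrixMultiplication.Theorems.ObstructionCalculus

/-! ### H9 at tree level -/

namespace Summit.MatrixMultiplication.MatrixMultiplication.Theses.ObstructionDescent

open Summit.MatrixMultiplication.MatrixMultiplication.Theorems.ObstructionCalculus

/-- **H9 at tree level: the invariant tower is a statement about secant varieties of the fixed corner format `n² × n² × n²`.**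
`InvariantSaturation` ⟺ for every scale `2 < τ < 4`, eventually in `n`, for `m ≥ n², n^τ`: every non-empty level `k` of degree
`k n² > m` has a weight vector non-zero at a corner point `[PA|PB|PC]` (a point of `σ_m(ℂ^{n²} ⊗ ℂ^{n²} ⊗ ℂ^{n²})`). [this node] -/
theorem invariantSaturation_iff_corner : InvariantSaturation ↔
    ∀ τ : ℝ, 2 < τ → τ < 4 → ∃ n₀ : ℕ, ∀ n m : ℕ, n₀ ≤ n → n * n ≤ m → (n : ℝ) ^ τ ≤ (m : ℝ) →
      ∀ k : ℕ, m < k * (n * n) → k ∉ emptyLevels m (n * n) →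
        ∃ A B C : Matrix (Fin m) (Fin m) ℂ, k ∈ pointLevels (n * n)
          (fromCols (lastProj m (n * n) * A) (lastProj m (n * n) * B) (lastProj m (n * n) * C)) := by
  rw [invariantSaturation_iff_levels]
  refine forall_congr' fun τ => forall_congr' fun _ => forall_congr' fun _ => exists_congr fun n₀ =>
    forall_congr' fun n => forall_congr' fun m => forall_congr' fun _ => forall_congr' fun _ =>
    forall_congr' fun _ => forall_congr' fun k => forall_congr' fun _ => ?_
  rw [Set.mem_union, ← mem_passLevels_iff_corner]
  tauto

end Summit.MatrixMultiplication.MatrixMultiplication.Theses.ObstructionDescent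

end
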